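import Literature.Geometry.Kaehler.ManifoldFormsChart
import Mathlib.Analysis.Calculus.ContDiff.CPolynomial
import Mathlib.Analysis.Analytic.CPolynomial
import Mathlib.Geometry.Manifold.VectorBundle.Tangent
import Mathlib.Geometry.Manifold.MFDeriv.Atlas
import HarnessLib

/-!
# Differential forms on manifolds: a smooth form evaluated on smooth vector fields is smooth

Layer `Literature/Geometry/Kaehler`, companion to `ManifoldFormsChart` (chart calculus of the
tree's forms `MForm I M F k`, smoothness `IsSmoothForm` = chart-wise `C^∞` representatives).
Lee, *Introduction to Smooth Manifolds*, 2nd ed., Prop. 14.26 (c)/(d): a (rough) differential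
form is smooth iff its value on smooth vector fields is a smooth function.  This file proves the
direction used to differentiate coefficients of a pulled-back form along families of vector
fields (step (S1b) of the unfolding of an origami form,
`Literature/Geometry/Symplectic/OrigamiFoldFirstOrder.lean`: `B₁ = ∂ₜ|₀ (c^*ω)(∂ₜ, X̃)` as a
smooth function on the fold), for an arbitrary boundaryless model `I`, any coefficient space `F`
and Mathlib's smooth sections of the tangent bundle:

* `contDiff_continuousAlternatingMap_uncurry` — the evaluation `(α, v) ↦ α v` of continuous
  alternating maps is `C^∞` jointly (Mathlib's
  `ContinuousLinearMap.cpolynomialAt_uncurry_of_multilinear` for the inclusion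
  `ContinuousAlternatingMap.toContinuousMultilinearMapCLM`: a continuous polynomial map);
* `MForm.apply_eq_inChart_trivializationAt` — `α_x(v) = (α.inChart x₀ (φ x))(w)` with `wᵢ` the
  fibre coordinates of `vᵢ` at `x₀` (the fibre coordinate is `tangentCoordChange I x x₀ x`
  definitionally, cf. `Literature.Topology.FourManifolds.trivializationAt_apply_snd`; change of
  chart of the representative, `MForm.inChart_apply`, and the round trip of coordinate changes);
* **`IsSmoothForm.contMDiffAt_apply_sections`** — if `α` is a smooth form and the vector
  fields `V₁, …, V_k` are `C^∞` at `x₀` (as maps into `TangentBundle I M`), then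
  `x ↦ α_x(V₁ x, …, V_k x)` is `C^∞` at `x₀`; `IsSmoothForm.contMDiff_apply_sections`,
  `IsSmoothForm.contMDiffOn_apply_sections`.

Everything here is proved; no definitions, no named facts (D-0026).

## References

* J. M. Lee, *Introduction to Smooth Manifolds*, 2nd ed., GTM 218 (2013), Prop. 14.26,
  Lemma 14.16. [LeeSmoothManifolds2013]
* F. W. Warner, *Foundations of Differentiable Manifolds and Lie Groups*, GTM 94 (1983), 2.15–2.18.
-/

noncomputable section

open scoped Manifold ContDiff Topology
open Bundle Set Filter

namespace Literature.Geometry.Kaehler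

/-! ### Joint smoothness of the evaluation of alternating maps -/

section Uncurry

variable {E : Type*} [NormedAddCommGroup E] [NormedSpace ℝ E]
  {F : Type*} [NormedAddCommGroup F] [NormedSpace ℝ F] {k : ℕ}

/-- **The evaluation `(α, v) ↦ α v` of continuous alternating maps is `C^∞`** jointly in the
map and the vectors (it is a continuous polynomial map: Mathlib's
`ContinuousLinearMap.cpolynomialAt_uncurry_of_multilinear` applied to the inclusion of
alternating maps into multilinear maps). [folklore] -/
theorem contDiff_continuousAlternatingMap_uncurry :
    ContDiff ℝ ∞ fun p : (E [⋀^Fin k]→L[ℝ] F) × (Fin k → E) => p.1 p.2 := by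
  rw [contDiff_iff_contDiffAt]
  intro p
  have h := (ContinuousAlternatingMap.toContinuousMultilinearMapCLM ℝ :
    (E [⋀^Fin k]→L[ℝ] F) →L[ℝ] ContinuousMultilinearMap ℝ (fun _ : Fin k => E) F)
      |>.cpolynomialAt_uncurry_of_multilinear (x := p)
  exact h.contDiffAt

end Uncurry

/-! ### Reading a form in the trivialisation of the tangent bundle -/

section Trivialization

variable {E : Type*} [NormedAddCommGroup E] [NormedSpace ℝ E]
  {H : Type*} [TopologicalSpace H] {I : ModelWithCorners ℝ E H}
  {M : Type*} [TopologicalSpace M] [ChartedSpace H M]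
  {F : Type*} [NormedAddCommGroup F] [NormedSpace ℝ F] {k : ℕ}

variable [IsManifold I ∞ M]

/-- **A form read in the trivialisation of `TM` at `x₀`**: for `x` in the chart domain at `x₀`,
`α_x(v₁, …, v_k) = (α.inChart x₀ (φ x))(w₁, …, w_k)` where `wᵢ` is the fibre coordinate of `vᵢ`
in the trivialisation at `x₀` (change of chart for the representative, and the round trip of
tangent coordinate changes). [folklore] -/
theorem MForm.apply_eq_inChart_trivializationAt (α : MForm I M F k) (x₀ : M) {x : M}
    (hx : x ∈ (extChartAt I x₀).source) (v : Fin k → TangentSpace I x) :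
    α x v = α.inChart x₀ (extChartAt I x₀ x)
      (fun i => (trivializationAt E (TangentSpace I) x₀ ⟨x, v i⟩).2) := by
  -- the fibre coordinate `(trivializationAt … x₀ ⟨x, w⟩).2` is `tangentCoordChange I x x₀ x w`
  -- (definitionally; cf. `Literature.Topology.FourManifolds.trivializationAt_apply_snd`)
  have key : ∀ (z : M) (_ : z = x),
      α z (fun i => tangentCoordChange I x₀ z z
        ((trivializationAt E (TangentSpace I) x₀ ⟨x, v i⟩).2)) =
        α x (fun i => tangentCoordChange I x₀ x x
          ((trivializationAt E (TangentSpace I) x₀ ⟨x, v i⟩).2)) := by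
    intro z hz
    subst hz
    rfl
  rw [MForm.inChart_apply, mfderivWithin_extChartAt_symm_eq_tangentCoordChange
    ((extChartAt I x₀).map_source hx)]
  refine Eq.trans ?_ (key _ ((extChartAt I x₀).left_inv hx)).symm
  congr 1
  funext i
  have hmem : x ∈ (extChartAt I x).source ∩ (extChartAt I x₀).source ∩ (extChartAt I x).source :=
    ⟨⟨mem_extChartAt_source x, hx⟩, mem_extChartAt_source x⟩
  exact ((tangentCoordChange_self (I := I) (v := (v i : E)) (mem_extChartAt_source x)).symm.trans
    (tangentCoordChange_comp (I := I) (v := (v i : E)) hmem).symm)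

end Trivialization

/-! ### Smoothness of the evaluation of a smooth form on smooth vector fields -/

section Eval

variable {E : Type*} [NormedAddCommGroup E] [NormedSpace ℝ E]
  {H : Type*} [TopologicalSpace H] {I : ModelWithCorners ℝ E H} [I.Boundaryless]
  {M : Type*} [TopologicalSpace M] [ChartedSpace H M] [IsManifold I ∞ M]
  {F : Type*} [NormedAddCommGroup F] [NormedSpace ℝ F] {k : ℕ}

/-- **A smooth form evaluated on vector fields smooth at `x₀` is smooth at `x₀`** (Lee 2013,
Prop. 14.26 (c): a differential form is smooth iff its value on smooth vector fields is a smooth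
function; here the easy direction, for the chart-wise smoothness `IsSmoothForm` of the tree and
Mathlib's smooth sections of the tangent bundle): read the form in the chart at `x₀` and the
fields in the trivialisation of `TM` at `x₀`, and use the joint smoothness of evaluation.
[cite: LeeSmoothManifolds2013, Prop. 14.26] -/
theorem IsSmoothForm.contMDiffAt_apply_sections {α : MForm I M F k} (hα : IsSmoothForm α)
    {V : Fin k → Π x : M, TangentSpace I x} {x₀ : M}
    (hV : ∀ i, ContMDiffAt I I.tangent ∞ (fun x => (⟨x, V i x⟩ : TangentBundle I M)) x₀) :
    ContMDiffAt I 𝓘(ℝ, F) ∞ (fun x => α x (fun i => V i x)) x₀ := by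
  set e := trivializationAt E (TangentSpace I : M → Type _) x₀ with he
  have hx₀ : x₀ ∈ e.baseSet := FiberBundle.mem_baseSet_trivializationAt' x₀
  -- the fibre coordinates of the fields are smooth functions at `x₀`
  have hw : ∀ i, ContMDiffAt I 𝓘(ℝ, E) ∞ (fun x => (e ⟨x, V i x⟩).2) x₀ := fun i =>
    (e.contMDiffAt_section_iff hx₀).1 (hV i)
  have hwpi : ContMDiffAt I 𝓘(ℝ, Fin k → E) ∞ (fun x => fun i => (e ⟨x, V i x⟩).2) x₀ :=
    contMDiffAt_pi_space.2 hw
  -- the chart representative, composed with the chart, is smooth at `x₀`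
  have hsrc : (extChartAt I x₀).source ∈ 𝓝 x₀ := extChartAt_source_mem_nhds x₀
  have hG : ContDiffAt ℝ ∞ (α.inChart x₀) (extChartAt I x₀ x₀) := by
    have := hα x₀
    rw [ModelWithCorners.Boundaryless.range_eq_univ (I := I)] at this
    exact this.contDiffAt univ_mem
  have hGφ : ContMDiffAt I 𝓘(ℝ, E [⋀^Fin k]→L[ℝ] F) ∞ (fun x => α.inChart x₀ (extChartAt I x₀ x)) x₀ :=
    hG.comp_contMDiffAt (contMDiffAt_extChartAt' (mem_chart_source H x₀))
  -- the composite `x ↦ (α.inChart x₀ (φ x)) (w x)` is smooth at `x₀`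
  have hcomp : ContMDiffAt I 𝓘(ℝ, F) ∞
      (fun x => (α.inChart x₀ (extChartAt I x₀ x)) (fun i => (e ⟨x, V i x⟩).2)) x₀ :=
    contDiff_continuousAlternatingMap_uncurry.comp_contMDiffAt (hGφ.prodMk_space hwpi)
  -- and agrees with `x ↦ α x (V x)` near `x₀`
  refine hcomp.congr_of_eventuallyEq ?_
  filter_upwards [hsrc] with x hx
  exact α.apply_eq_inChart_trivializationAt x₀ hx _

/-- **A smooth form evaluated on smooth vector fields is a smooth function.**
[cite: LeeSmoothManifolds2013, Prop. 14.26] -/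
theorem IsSmoothForm.contMDiff_apply_sections {α : MForm I M F k} (hα : IsSmoothForm α)
    {V : Fin k → Π x : M, TangentSpace I x}
    (hV : ∀ i, ContMDiff I I.tangent ∞ (fun x => (⟨x, V i x⟩ : TangentBundle I M))) :
    ContMDiff I 𝓘(ℝ, F) ∞ fun x => α x (fun i => V i x) := fun _ =>
  hα.contMDiffAt_apply_sections fun i => (hV i).contMDiffAt

/-- A smooth form evaluated on vector fields smooth on an open set is smooth there.
[cite: LeeSmoothManifolds2013, Prop. 14.26] -/
theorem IsSmoothForm.contMDiffOn_apply_sections {α : MForm I M F k} (hα : IsSmoothForm α)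
    {V : Fin k → Π x : M, TangentSpace I x} {s : Set M} (hs : IsOpen s)
    (hV : ∀ i, ContMDiffOn I I.tangent ∞ (fun x => (⟨x, V i x⟩ : TangentBundle I M)) s) :
    ContMDiffOn I 𝓘(ℝ, F) ∞ (fun x => α x (fun i => V i x)) s := fun x hx =>
  (hα.contMDiffAt_apply_sections fun i => (hV i x hx).contMDiffAt (hs.mem_nhds hx)).contMDiffWithinAt

end Eval

end Literature.Geometry.Kaehler

end
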